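import Summits.AtomisticToContinuum.HydrodynamicLimit.Theses.InformationPercolationEngine
import Summits.AtomisticToContinuum.HydrodynamicLimit.Theorems.InformationPercolationEngineSpectralContractionR

/-!
# The rev-12 refutation burden and the window of `PercolationClosesChaos` (negative helper, stmt-AtomisticToContinuum-15178)

Refuter material (`Cruxes/PercolationClosesChaos/Disproof.lean` §1/§1b, findings F16–F17, seat
`refuter-cdisprove-stmt-AtomisticToContinuum-15178-0`, 2026-08-16). The crux at rev 12 is
`KickFairRelEquilibriumMeso → SpectralContractionR → ContactChaos`, and `SpectralContractionR` (crux 3, stmt-13913) is a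
THEOREM since 13:14Z (`…SwapSymmetrisation.SpectralContractionR_proof`, `c = 1/4`). Consequences, kernel-checked:

* `not_percolationClosesChaos_iff` — a refutation is EXACTLY a proof of crux 2 (`KickFairRelEquilibriumMeso`, open-problem
  class) together with a refutation of the route TARGET `ContactChaos` (summit-level negative evidence); nothing less, so no
  `_false_without_` certificate can exist for this dock;
* `percolationClosesChaos_iff_forall_cells` — the engine must run on EVERY admissible cell sequence `rs` (positive,
  `rs → 0`, `(N+1) rs³ → ∞`): the prover fixes an arbitrary one and then knows only `rs → 0` and, by
  `tendsto_hsDiameter_div_cells`, `ε_N / rs N = σ ((N+1) rs_N³)^(-1/3) → 0` (the typed LOWER edge alone; the upper edge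
  `rs ≪ N^(-1/6)` of the planner's window is the kick prover's choice and may NOT be assumed by the engine);
* `window_default_*` — the planner's default `(N+1)^(-1/4)` is admissible (the hypothesis of crux 2 is not vacuous by an empty
  window).
No statement of the route is asserted positively (equivalences and limits only).
-/

noncomputable section

open MeasureTheory Filter Topology
open scoped Classical
open Literature.Analysis.FluidPDE Literature.MathematicalPhysics.KineticTheory
open Summit.AtomisticToContinuum.HydrodynamicLimit.Theses.InformationPercolationEngine

namespace Summit.AtomisticToContinuum.HydrodynamicLimit.Theorems.PercolationClosesChaos.Negative

/-- **Refutation burden at rev 12.** With crux 3 proved, `¬ PercolationClosesChaos ↔ KickFairRelEquilibriumMeso ∧ ¬ ContactChaos`.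
[folklore] -/
theorem not_percolationClosesChaos_iff :
    ¬ PercolationClosesChaos ↔ (KickFairRelEquilibriumMeso ∧ ¬ ContactChaos) := by
  have hS : SpectralContractionR :=
    Summit.AtomisticToContinuum.HydrodynamicLimit.Cruxes.SpectralContractionR.SwapSymmetrisation.SpectralContractionR_proof
  unfold PercolationClosesChaos
  constructor
  · intro h
    by_contra hc
    exact h fun hK _ => Classical.by_contradiction fun hC => hc ⟨hK, hC⟩
  · rintro ⟨hK, hC⟩ h
    exact hC (h hK hS)

/-- **The lower edge of the window, in the form the engine consumes**: along every admissible cell sequence the diameter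
is negligible against the cell, `ε_N / rs N → 0`, at every fixed `σ`. [folklore] -/
theorem tendsto_hsDiameter_div_cells (σ : ℝ) {rs : ℕ → ℝ} (hpos : ∀ N, 0 < rs N)
    (hwin : Tendsto (fun N : ℕ => ((N : ℝ) + 1) * rs N ^ 3) atTop atTop) :
    Tendsto (fun N : ℕ => hsDiameter σ N / rs N) atTop (𝓝 0) := by
  have key : ∀ N : ℕ, hsDiameter σ N / rs N = σ * ((((N : ℝ) + 1) * rs N ^ 3) ^ (-(1 / 3 : ℝ))) := by
    intro N
    have hN : (0 : ℝ) ≤ (N : ℝ) + 1 := by positivity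
    have hr := hpos N
    have h3 : (rs N ^ 3 : ℝ) ^ (-(1 / 3 : ℝ)) = (rs N)⁻¹ := by
      rw [← Real.rpow_natCast (rs N) 3, ← Real.rpow_mul hr.le]
      norm_num
      exact Real.rpow_neg_one (rs N)
    rw [Real.mul_rpow hN (by positivity), h3, hsDiameter]
    push_cast
    ring
  simp_rw [key]
  simpa using ((tendsto_rpow_neg_atTop (by norm_num : (0 : ℝ) < 1 / 3)).comp hwin).const_mul σ

/-- The planner's default cell sequence `(N+1)^(-1/4)` is positive. [folklore] -/
theorem window_default_pos (N : ℕ) : 0 < ((N : ℝ) + 1) ^ (-(1 / 4 : ℝ)) :=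
  Real.rpow_pos_of_pos (by positivity) _

/-- … tends to `0`. [folklore] -/
theorem window_default_tendsto_zero : Tendsto (fun N : ℕ => ((N : ℝ) + 1) ^ (-(1 / 4 : ℝ))) atTop (𝓝 0) :=
  (tendsto_rpow_neg_atTop (by norm_num : (0 : ℝ) < 1 / 4)).comp
    (tendsto_natCast_atTop_atTop.atTop_add (tendsto_const_nhds (x := (1 : ℝ))))

/-- … and has `(N+1) rs_N³ = (N+1)^(1/4) → ∞`: the window of `KickFairRelEquilibriumMeso` is inhabited. [folklore] -/
theorem window_default_tendsto_atTop :
    Tendsto (fun N : ℕ => ((N : ℝ) + 1) * (((N : ℝ) + 1) ^ (-(1 / 4 : ℝ))) ^ 3) atTop atTop := by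
  have key : ∀ N : ℕ, ((N : ℝ) + 1) * (((N : ℝ) + 1) ^ (-(1 / 4 : ℝ))) ^ 3 = ((N : ℝ) + 1) ^ (1 / 4 : ℝ) := by
    intro N
    have hN : (0 : ℝ) < (N : ℝ) + 1 := by positivity
    rw [← Real.rpow_natCast _ 3, ← Real.rpow_mul hN.le]
    conv_lhs => rw [show ((N : ℝ) + 1) = ((N : ℝ) + 1) ^ (1 : ℝ) from (Real.rpow_one _).symm]
    rw [← Real.rpow_mul hN.le, ← Real.rpow_add hN]
    norm_num
  simp_rw [key]
  exact (tendsto_rpow_atTop (by norm_num : (0 : ℝ) < 1 / 4)).comp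
    (tendsto_natCast_atTop_atTop.atTop_add (tendsto_const_nhds (x := (1 : ℝ))))

/-- **The engine's burden at rev 12.** `PercolationClosesChaos` is: FOR EVERY admissible cell sequence, the body of crux 2
along it (verbatim) gives the target. [folklore] -/
theorem percolationClosesChaos_iff_forall_cells :
    PercolationClosesChaos ↔ ∀ rs : ℕ → ℝ, (∀ N, 0 < rs N) → Tendsto rs atTop (𝓝 0) →
      Tendsto (fun N : ℕ => ((N : ℝ) + 1) * rs N ^ 3) atTop atTop →
      (∀ (a₀ θ₀ : T3 → ℝ) (u₀ : T3 → V3), Continuous a₀ → Continuous θ₀ → Continuous u₀ → (∀ x, 0 < a₀ x) →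
        (∀ x, 0 < θ₀ x) → ∃ σ₀ : ℝ, 0 < σ₀ ∧ ∀ σ : ℝ, 0 < σ → σ < σ₀ → ∀ Φ : (N : ℕ) →
        HardSphereFlow (Torus.geometry (Fin 3)) (hsDiameter σ N) (N + 1), ∀ τ : ℝ, 0 < τ →
        ∀ g : V3 × V3 × V3 → ℝ, Continuous g → (∃ C : ℝ, ∀ p, |g p| ≤ C) → ∀ δ : ℝ, 0 < δ →
        ∃ N₀ : ℕ, ∀ N : ℕ, N₀ ≤ N → ∀ h : Fin (N + 1) → ℕ → (((Fin (N + 1) → (Fin 3 →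
        ℤ) × V3) × (Fin (N + 1) → (Fin 3 → ℤ) × V3)) × Fin (N + 1)) × (ℝ × ℝ × ℝ) →
        ℝ, (∀ i n, Measurable (h i n)) → (∀ i n p, |h i n p| ≤ 1) →
        let ε := hsDiameter σ N
        let G : Geometry (Fin 3) T3 := Torus.geometry (Fin 3)
        let q : T3 → (Fin 3 → ℤ) := Torus.coarseCell (rs N)
        let γ : Config (N + 1) (Fin 3) T3 → ℝ → Config (N + 1) (Fin 3) T3 := fun z s => (Φ N).flow s z
        let cnt : Config (N + 1) (Fin 3) T3 → Fin (N + 1) → ℕ := fun z i => Set.ncard (collisionTimesOf G ε (γ z) i ∩ Set.Ioc 0 τ)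
        let P : Config (N + 1) (Fin 3) T3 → Fin (N + 1) → ℕ → (((Fin (N + 1) → (Fin 3 → ℤ) × V3) × (Fin (N + 1) → (Fin 3 → ℤ) × V3)) × Fin (N + 1)) × (ℝ × ℝ × ℝ) := fun z i n => if z ∈ (Φ N).good then (((Φ N).coarsePastOf q i n z, (Φ N).nthPartnerOf i n z), (flightStart G ε (γ z) 0 i ((Φ N).nthCollisionTimeOf i n z), flightStart G ε (γ z) 0 ((Φ N).nthPartnerOf i n z) ((Φ N).nthCollisionTimeOf i n z), (Φ N).nthCollisionTimeOf i n z)) else (((fun _ => (0, 0), fun _ => (0, 0)), 0), (0, 0, 0))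
        let X : Fin (N + 1) → ℕ → Config (N + 1) (Fin 3) T3 → V3 × V3 × V3 := fun i n z => if z ∈ (Φ N).good then (((Φ N).nthRecordOf i n z).impactVec, ((Φ N).nthRecordOf i n z).preVel) else 0
        let κ : Fin (N + 1) → ℕ → Config (N + 1) (Fin 3) T3 → ℝ := fun i n => MeasureTheory.condExp (MeasurableSpace.comap (fun z => P z i n) inferInstance) (localGibbsLaw σ (fun _ => 1) (fun _ => 0) (fun _ => 1) N (Φ N)) (fun z => g (X i n z))
        let S : Config (N + 1) (Fin 3) T3 → ℝ := fun z => ε / (N + 1 : ℝ) * ∑ i : Fin (N + 1), ∑ n ∈ Finset.range (cnt z i), h i n (P z i n) * (g (X i n z) - κ i n z)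
        ∫⁻ z, ENNReal.ofReal |S z| ∂(localGibbsLaw σ a₀ u₀ θ₀ N (Φ N)) ≤ ENNReal.ofReal δ) →
      ContactChaos := by
  have hS : SpectralContractionR :=
    Summit.AtomisticToContinuum.HydrodynamicLimit.Cruxes.SpectralContractionR.SwapSymmetrisation.SpectralContractionR_proof
  constructor
  · intro h rs h1 h2 h3 h4
    exact h ⟨rs, h1, h2, h3, h4⟩ hS
  · rintro h ⟨rs, h1, h2, h3, h4⟩ _
    exact h rs h1 h2 h3 h4

end Summit.AtomisticToContinuum.HydrodynamicLimit.Theorems.PercolationClosesChaos.Negative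

end
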